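import Literature.NumberTheory.GaloisRepresentations.RestrictedRamification
import Literature.NumberTheory.GaloisRepresentations.GaloisRep
import Literature.NumberTheory.ComplexMultiplication.EllipticUnits.ImaginaryQuadraticMainConjectureCarriers
import HarnessLib

/-!
# Route `SignedLowerHalves`, crux L `SmallImageLowerHalfBothSigns` (stmt-BirchSwinnertonDyer-23599), line `rtt_w3` v15 — stub A bookkeeping (bk3, LEAD):
# A CONTINUOUS CHARACTER UNRAMIFIED OUTSIDE `S` IS TRIVIAL ON THE RAMIFICATION SUBGROUP `N_S`; `det θ` on `N_{supp(p𝔣)}`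

WHY (v15 `CharRoadFrameProps` needs honda's `hN`: `θ' = χ₀ (mod p^k)` on `N_S = ramificationSubgroup K (suppPF p 𝔣)`, obtained from `hN_of_trivial` once `θ'` and `χ₀`
are trivial there; `θ' = (det θ)⁻¹` and `χ₀` is the Teichmüller part of `θ'`, so everything reduces to `det θ = 1` on `N_S`). The tree's `ramificationSubgroup_le_ker`
asks for an OPEN kernel (finite image); a continuous `𝒪ˣ`-valued character has only a CLOSED kernel — which is all the closure argument needs.
★ `eq_one_of_mem_ramificationSubgroup` (any continuous hom into a `T1` topological group, trivial on the inertia groups above the places outside `S`, is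
trivial on `N_S`); ★★ `det_eq_one_of_mem_ramificationSubgroup` (for a framed Galois representation unramified outside `S`); ★ `not_mem_and_not_le_of_not_mem_suppPF`
(`v ∉ supp(p·𝔪·𝔫) ⇒ p ∉ v ∧ ¬ 𝔪 ≤ v`, the shape of the stub's unramifiedness hypothesis `hθ`). THEOREMS ONLY (`--supports stmt-BirchSwinnertonDyer-23599` helper).
[cite: NeukirchSchmidtWingberg2008, VIII §3] [cite: SerreAbelianLadic1968, Ch. I §2.1] [folklore]
-/

set_option autoImplicit false
-- the Theorems namespace of this sub repeats the summit name by design (D-0017 nested layout)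
set_option linter.dupNamespace false

noncomputable section

open scoped NumberField
open Field IsDedekindDomain
open Literature.NumberTheory.GaloisRepresentations

namespace Summit.BirchSwinnertonDyer.BirchSwinnertonDyer.Theorems.SmallImageRttD2Twist

section Ramification

variable {K : Type} [Field K] [NumberField K] (S : Set (HeightOneSpectrum (𝓞 K)))

omit [NumberField K] in
/-- ★ **A continuous homomorphism into a `T1` group that kills the inertia groups above the places outside `S` kills `N_S`** (its kernel is a CLOSED normal
subgroup containing `inertiaOutside K S`). [cite: NeukirchSchmidtWingberg2008, VIII §3] -/
theorem eq_one_of_mem_ramificationSubgroup {H : Type*} [Group H] [TopologicalSpace H] [T1Space H]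
    (f : absoluteGaloisGroup K →ₜ* H) (hS : ∀ v ∉ S, ∀ 𝔓 ∈ v.primesAbove, ∀ σ ∈ 𝔓.inertia (absoluteGaloisGroup K), f σ = 1)
    {σ : absoluteGaloisGroup K} (hσ : σ ∈ ramificationSubgroup K S) : f σ = 1 := by
  have hclosed : IsClosed ((f.toMonoidHom.ker : Subgroup (absoluteGaloisGroup K)) : Set (absoluteGaloisGroup K)) := by
    have : ((f.toMonoidHom.ker : Subgroup (absoluteGaloisGroup K)) : Set (absoluteGaloisGroup K)) = f ⁻¹' {1} := by
      ext τ; simp [MonoidHom.mem_ker]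
    rw [this]
    exact isClosed_singleton.preimage f.continuous_toFun
  have hle : ramificationSubgroup K S ≤ f.toMonoidHom.ker := by
    refine Subgroup.topologicalClosure_minimal _ ?_ hclosed
    refine Subgroup.normalClosure_le_normal fun τ hτ ↦ ?_
    rw [mem_inertiaOutside_iff] at hτ
    obtain ⟨v, hv, 𝔓, h𝔓, hτ⟩ := hτ
    exact hS v hv 𝔓 h𝔓 τ hτ
  exact hle hσ

omit [NumberField K] in
/-- ★★ **`det θ = 1` on `N_S`** for a framed Galois representation `θ` unramified at every place outside `S` (and `T1` coefficients). [cite: SerreAbelianLadic1968, Ch. I §2.1]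
[cite: NeukirchSchmidtWingberg2008, VIII §3] -/
theorem det_eq_one_of_mem_ramificationSubgroup {A : Type*} [CommRing A] [TopologicalSpace A] [IsTopologicalRing A] [T1Space A] {n : ℕ}
    (θ : FramedGaloisRep K A n) (hθ : ∀ v ∉ S, θ.IsUnramifiedAt v) {σ : absoluteGaloisGroup K} (hσ : σ ∈ ramificationSubgroup K S) :
    FramedRep.det θ σ = 1 := by
  refine eq_one_of_mem_ramificationSubgroup S (FramedRep.det θ) (fun v hv 𝔓 h𝔓 τ hτ ↦ ?_) hσ
  rw [FramedRep.det_apply, hθ v hv 𝔓 h𝔓 τ hτ, map_one]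

/-- ★ **Outside `supp(p · 𝔫)` with `𝔪 ∣ 𝔫`**: `v ∉ suppPF p 𝔫 ⇒ p ∉ v ∧ ¬ 𝔪 ≤ v` — the hypotheses of the stub's unramifiedness clause `hθ`.
[cite: JohnsonLeungKings2011, Cor. 5.3 (S = supp p𝔣)] -/
theorem not_mem_and_not_le_of_not_mem_suppPF {p : ℕ} {𝔪 𝔫 : Ideal (𝓞 K)} (h𝔪 : 𝔪 ∣ 𝔫) {v : HeightOneSpectrum (𝓞 K)}
    (hv : v ∉ Literature.NumberTheory.ComplexMultiplication.EllipticUnits.JohnsonLeungKings2011.suppPF p 𝔫) :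
    (p : 𝓞 K) ∉ v.asIdeal ∧ ¬ 𝔪 ≤ v.asIdeal := by
  have hv' : ¬ v.asIdeal ∣ Ideal.span {((p : ℕ) : 𝓞 K)} * 𝔫 := hv
  constructor
  · intro hp
    apply hv'
    exact dvd_mul_of_dvd_left ((Ideal.dvd_span_singleton).mpr hp) _
  · intro hle
    apply hv'
    exact dvd_mul_of_dvd_right ((Ideal.dvd_iff_le.mpr hle).trans h𝔪) _

end Ramification

end Summit.BirchSwinnertonDyer.BirchSwinnertonDyer.Theorems.SmallImageRttD2Twist

end
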